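import Mathlib
import Summits.ValiantsHypothesis.ValiantsHypothesis.Theorems.NewtonUnitEquationsTwoProductsDepthOne
/-! # Stub `stub_engineDepthK` — crux `TwoProducts` (stmt-ValiantsHypothesis-5906), line `corner-log-linearization`
   The BOUNDED-DEPTH CASCADE rung of the engine (n-uniform, polynomial in `t` for fixed depth `k`).

   Setting: `W = ∏ u_i - ∏ v_i` for arbitrary bivariate `u_i, v_i`, sparsity `≤ t`.  A south-west
   vertex is a strict minimiser over `supp W` of a linear form with both weights positive.  This file
   generalises the landed depth-one rung (`TwoProducts.DepthOne.stub_engineDepthOne`, the case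
   `k = 2`).  Structure lemma (`rep_le_k`): write a vertex `e ∈ supp ∏ u_i` as `e = Σ_i a_i` with
   `a_i ∈ supp u_i` (`DepthOne.exists_rep_of_mem_support_prod`) and let `J` be the set of indices
   with `a_i ≠ 0`.  If `|J| > k`, pick `J' ⊆ J` with `|J'| = k`: every `a_i` (`i ∈ J'`) is a proper
   partial sum of `e`, hence strictly lighter (`DepthOne.wt_partial_lt`), hence DEAD (not in
   `supp W`, by strict minimality of `e`); the cascade hypothesis (H_k) then says `Σ_{J'} a_i` is
   ALIVE, but it is again a proper partial sum of `e`, strictly lighter — contradiction.  So `|J| ≤ k`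
   and `e` is a sum of at most `k` letters of the alphabet `⋃_i supp u_i` (size `≤ nt`), i.e. a
   `k`-fold sum from `{0} ∪ ⋃_i supp u_i`: at most `(nt+1)^k` points (`exists_cover`).  Same on the
   `v` side, whence at most `2(nt+1)^k ≤ 2(nt+1)^k + 1` south-west vertices. [folklore] -/
set_option linter.dupNamespace false -- single-conjunct summit: `ValiantsHypothesis.ValiantsHypothesis`
namespace Summit.ValiantsHypothesis.ValiantsHypothesis.Theorems.TwoProducts.DepthK
open scoped BigOperators Pointwise
open Summit.ValiantsHypothesis.ValiantsHypothesis.Theorems.TwoProducts.DepthOne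

/-- COUNTING LEMMA.  If `0 ∈ Z` then all sums of at most `m` elements of `Z` (indexed by a finset
`J` with `J.card ≤ m`) lie in one finset of cardinality `≤ Z.card ^ m` (namely the `m`-fold
pointwise sum of `Z`). [folklore] -/
theorem exists_cover {ι : Type*} (Z : Finset (Fin 2 →₀ ℕ)) (h0 : 0 ∈ Z) :
    ∀ m : ℕ, ∃ P : Finset (Fin 2 →₀ ℕ), P.card ≤ Z.card ^ m ∧
      ∀ (J : Finset ι) (b : ι → (Fin 2 →₀ ℕ)), J.card ≤ m → (∀ i ∈ J, b i ∈ Z) →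
        ∑ i ∈ J, b i ∈ P := by
  classical
  intro m
  induction m with
  | zero =>
    refine ⟨{0}, by simp, ?_⟩
    intro J b hJ _
    have hJ0 : J = ∅ := Finset.card_eq_zero.mp (Nat.le_zero.mp hJ)
    simp [hJ0]
  | succ m ih =>
    obtain ⟨P, hPcard, hP⟩ := ih
    refine ⟨P + Z, ?_, ?_⟩
    · calc (P + Z).card ≤ P.card * Z.card := Finset.card_add_le
        _ ≤ Z.card ^ m * Z.card := Nat.mul_le_mul_right _ hPcard
        _ = Z.card ^ (m + 1) := (pow_succ _ _).symm
    · intro J b hJ hb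
      by_cases hJm : J.card ≤ m
      · rw [← add_zero (∑ i ∈ J, b i)]
        exact Finset.add_mem_add (hP J b hJm hb) h0
      · have hJne : J.Nonempty := by
          rw [Finset.nonempty_iff_ne_empty]
          rintro rfl
          simp at hJm
        obtain ⟨i, hi⟩ := hJne
        rw [← Finset.sum_erase_add J b hi]
        refine Finset.add_mem_add (hP (J.erase i) b ?_
          fun j hj => hb j (Finset.mem_of_mem_erase hj)) (hb i hi)
        rw [Finset.card_erase_of_mem hi]
        omega

/-- STRUCTURE LEMMA (depth `k`).  Let `e ∈ supp ∏ u_i` be a strict minimiser of a positive-weight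
form over a finset `S`, and assume the depth-`k` cascade hypothesis (H_k) for the family `u`
relative to `S`: for every `k`-set `J` of indices and DEAD (not in `S`) nonzero letters
`a_i ∈ supp u_i` (`i ∈ J`), the sum `Σ_{i ∈ J} a_i` is ALIVE (in `S`).  Then `e` is a sum of at most
`k` letters `a_i ∈ supp u_i` with distinct indices. [folklore] -/
theorem rep_le_k {n : ℕ} (k : ℕ) (u : Fin n → MvPolynomial (Fin 2) ℂ) (S : Finset (Fin 2 →₀ ℕ))
    (hH : ∀ (J : Finset (Fin n)) (a : Fin n → (Fin 2 →₀ ℕ)), J.card = k → (∀ i ∈ J, a i ≠ 0) →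
      (∀ i ∈ J, a i ∈ (u i).support) → (∀ i ∈ J, a i ∉ S) → ∑ i ∈ J, a i ∈ S)
    (w : Fin 2 → ℤ) (hw0 : 0 < w 0) (hw1 : 0 < w 1) (e : Fin 2 →₀ ℕ)
    (hmin : ∀ e' ∈ S, e' ≠ e → w 0 * (e 0 : ℤ) + w 1 * (e 1 : ℤ) < w 0 * (e' 0 : ℤ) + w 1 * (e' 1 : ℤ))
    (he : e ∈ (∏ i, u i).support) :
    ∃ (J : Finset (Fin n)) (a : Fin n → (Fin 2 →₀ ℕ)), J.card ≤ k ∧ (∀ i ∈ J, a i ∈ (u i).support) ∧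
      e = ∑ i ∈ J, a i := by
  classical
  obtain ⟨a, ha, rfl⟩ := exists_rep_of_mem_support_prod n u e he
  -- a lighter point of S contradicts minimality
  have noLighter : ∀ p ∈ S, ¬ (w 0 * (p 0 : ℤ) + w 1 * (p 1 : ℤ) <
      w 0 * ((∑ i, a i) 0 : ℤ) + w 1 * ((∑ i, a i) 1 : ℤ)) := by
    intro p hp hlt
    have hne : p ≠ ∑ i, a i := by
      rintro rfl
      exact lt_irrefl _ hlt
    exact lt_asymm hlt (hmin p hp hne)
  -- the indices of the nonzero parts
  set J : Finset (Fin n) := Finset.univ.filter (fun i => a i ≠ 0) with hJ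
  have hmemJ : ∀ i, i ∈ J ↔ a i ≠ 0 := by
    intro i
    simp [hJ]
  have hsumJ : ∑ i ∈ J, a i = ∑ i, a i := by
    rw [hJ]
    exact Finset.sum_filter_ne_zero _
  by_cases hk : J.card ≤ k
  · exact ⟨J, a, hk, fun i _ => ha i, hsumJ.symm⟩
  exfalso
  push Not at hk
  obtain ⟨J', hJ'J, hJ'card⟩ := Finset.exists_subset_card_eq hk.le
  -- an index of a nonzero part outside `J'`
  obtain ⟨l, hlJ, hlJ'⟩ := Finset.exists_mem_notMem_of_card_lt_card
    (show J'.card < J.card by omega)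
  have hal : a l ≠ 0 := (hmemJ l).mp hlJ
  -- every part indexed by `J'` is dead
  have dead : ∀ i ∈ J', a i ∉ S := by
    intro i hi hiS
    have hk1 : ({i} : Finset (Fin n)).card < J.card := by
      have h1 : 1 ≤ J'.card := Finset.card_pos.mpr ⟨i, hi⟩
      rw [Finset.card_singleton]
      omega
    obtain ⟨m, hmJ, hmi⟩ := Finset.exists_mem_notMem_of_card_lt_card hk1
    apply noLighter (a i) hiS
    have := wt_partial_lt w hw0 hw1 a {i} m hmi ((hmemJ m).mp hmJ)
    simpa using this
  have hS : ∑ i ∈ J', a i ∈ S :=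
    hH J' a hJ'card (fun i hi => (hmemJ i).mp (hJ'J hi)) (fun i _ => ha i) dead
  exact noLighter _ hS (wt_partial_lt w hw0 hw1 a J' l hlJ' hal)

/-- STUB `stub_engineDepthK` (bounded-depth cascade rung of the engine, n-uniform and polynomial
for fixed depth `k`): for `W = ∏ u_i - ∏ v_i` with `t`-sparse factors, if for every `k`-set `J` of
indices the sum of DEAD (coefficient of `W` zero) nonzero monomials `a_i` of the factors `u_i`
(`i ∈ J`) is ALIVE (coefficient of `W` nonzero), and likewise for the `v_i`, then `W` has at most
`2(nt+1)^k + 1` south-west vertices. [folklore] -/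
theorem stub_engineDepthK : ∀ (n t k : ℕ) (u v : Fin n → MvPolynomial (Fin 2) ℂ), (∀ i, (u i).support.card ≤ t) → (∀ i, (v i).support.card ≤ t) → (∀ (J : Finset (Fin n)) (a : Fin n → (Fin 2 →₀ ℕ)), J.card = k → (∀ i ∈ J, a i ≠ 0) → (∀ i ∈ J, a i ∈ (u i).support) → (∀ i ∈ J, MvPolynomial.coeff (a i) (∏ i, u i - ∏ i, v i) = 0) → MvPolynomial.coeff (∑ i ∈ J, a i) (∏ i, u i - ∏ i, v i) ≠ 0) → (∀ (J : Finset (Fin n)) (a : Fin n → (Fin 2 →₀ ℕ)), J.card = k → (∀ i ∈ J, a i ≠ 0) → (∀ i ∈ J, a i ∈ (v i).support) → (∀ i ∈ J, MvPolynomial.coeff (a i) (∏ i, u i - ∏ i, v i) = 0) → MvPolynomial.coeff (∑ i ∈ J, a i) (∏ i, u i - ∏ i, v i) ≠ 0) → ({e : Fin 2 →₀ ℕ | ∃ w : Fin 2 → ℤ, 0 < w 0 ∧ 0 < w 1 ∧ ((e) ∈ ((∏ i, u i - ∏ i, v i).support) ∧ ∀ e' ∈ ((∏ i, u i - ∏ i,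 v i).support), e' ≠ (e) → ((w) 0 * ((e) 0 : ℤ) + (w) 1 * ((e) 1 : ℤ)) < ((w) 0 * ((e') 0 : ℤ) + (w) 1 * ((e') 1 : ℤ)))}).ncard ≤ 2 * (n * t + 1) ^ k + 1 := by
  intro n t k u v hu hv hHu hHv
  classical
  set W := ∏ i, u i - ∏ i, v i with hW
  set S := W.support with hS
  -- (H_k) in membership form
  have hHu' : ∀ (J : Finset (Fin n)) (a : Fin n → (Fin 2 →₀ ℕ)), J.card = k → (∀ i ∈ J, a i ≠ 0) →
      (∀ i ∈ J, a i ∈ (u i).support) → (∀ i ∈ J, a i ∉ S) → ∑ i ∈ J, a i ∈ S := by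
    intro J a hJ h0 hsupp hdead
    rw [hS, MvPolynomial.mem_support_iff]
    exact hHu J a hJ h0 hsupp fun i hi => MvPolynomial.notMem_support_iff.mp (hdead i hi)
  have hHv' : ∀ (J : Finset (Fin n)) (a : Fin n → (Fin 2 →₀ ℕ)), J.card = k → (∀ i ∈ J, a i ≠ 0) →
      (∀ i ∈ J, a i ∈ (v i).support) → (∀ i ∈ J, a i ∉ S) → ∑ i ∈ J, a i ∈ S := by
    intro J a hJ h0 hsupp hdead
    rw [hS, MvPolynomial.mem_support_iff]
    exact hHv J a hJ h0 hsupp fun i hi => MvPolynomial.notMem_support_iff.mp (hdead i hi)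
  -- the alphabets (with `0` adjoined) and their `k`-fold sum covers
  set Zu : Finset (Fin 2 →₀ ℕ) := insert 0 (Finset.univ.biUnion fun i => (u i).support) with hZu
  set Zv : Finset (Fin 2 →₀ ℕ) := insert 0 (Finset.univ.biUnion fun i => (v i).support) with hZv
  obtain ⟨Pu, hPucard, hPu⟩ := exists_cover (ι := Fin n) Zu (Finset.mem_insert_self _ _) k
  obtain ⟨Pv, hPvcard, hPv⟩ := exists_cover (ι := Fin n) Zv (Finset.mem_insert_self _ _) k
  set SW := {e : Fin 2 →₀ ℕ | ∃ w : Fin 2 → ℤ, 0 < w 0 ∧ 0 < w 1 ∧ (e ∈ S ∧ ∀ e' ∈ S, e' ≠ e →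
      w 0 * (e 0 : ℤ) + w 1 * (e 1 : ℤ) < w 0 * (e' 0 : ℤ) + w 1 * (e' 1 : ℤ))} with hSW
  have hsub : SW ⊆ ↑(Pu ∪ Pv) := by
    rintro e ⟨w, hw0, hw1, he, hmin⟩
    rw [Finset.mem_coe, Finset.mem_union]
    rcases Finset.mem_union.mp (MvPolynomial.support_sub _ _ _ he) with h | h
    · obtain ⟨J, a, hJk, ha, rfl⟩ := rep_le_k k u S hHu' w hw0 hw1 e hmin h
      refine Or.inl (hPu J a hJk fun i hi => ?_)
      rw [hZu, Finset.mem_insert, Finset.mem_biUnion]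
      exact Or.inr ⟨i, Finset.mem_univ i, ha i hi⟩
    · obtain ⟨J, a, hJk, ha, rfl⟩ := rep_le_k k v S hHv' w hw0 hw1 e hmin h
      refine Or.inr (hPv J a hJk fun i hi => ?_)
      rw [hZv, Finset.mem_insert, Finset.mem_biUnion]
      exact Or.inr ⟨i, Finset.mem_univ i, ha i hi⟩
  -- cardinalities
  have hZucard : Zu.card ≤ n * t + 1 := by
    rw [hZu]
    calc (insert 0 (Finset.univ.biUnion fun i => (u i).support)).card
          ≤ (Finset.univ.biUnion fun i => (u i).support).card + 1 := Finset.card_insert_le _ _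
      _ ≤ Finset.univ.card * t + 1 :=
          Nat.add_le_add_right (Finset.card_biUnion_le_card_mul _ _ _ fun i _ => hu i) 1
      _ = n * t + 1 := by rw [Finset.card_univ, Fintype.card_fin]
  have hZvcard : Zv.card ≤ n * t + 1 := by
    rw [hZv]
    calc (insert 0 (Finset.univ.biUnion fun i => (v i).support)).card
          ≤ (Finset.univ.biUnion fun i => (v i).support).card + 1 := Finset.card_insert_le _ _
      _ ≤ Finset.univ.card * t + 1 :=
          Nat.add_le_add_right (Finset.card_biUnion_le_card_mul _ _ _ fun i _ => hv i) 1
      _ = n * t + 1 := by rw [Finset.card_univ, Fintype.card_fin]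
  calc SW.ncard ≤ (↑(Pu ∪ Pv) : Set (Fin 2 →₀ ℕ)).ncard :=
        Set.ncard_le_ncard hsub (Pu ∪ Pv).finite_toSet
    _ = (Pu ∪ Pv).card := Set.ncard_coe_finset _
    _ ≤ Pu.card + Pv.card := Finset.card_union_le _ _
    _ ≤ Zu.card ^ k + Zv.card ^ k := Nat.add_le_add hPucard hPvcard
    _ ≤ (n * t + 1) ^ k + (n * t + 1) ^ k :=
        Nat.add_le_add (Nat.pow_le_pow_left hZucard k) (Nat.pow_le_pow_left hZvcard k)
    _ ≤ 2 * (n * t + 1) ^ k + 1 := by omega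

end Summit.ValiantsHypothesis.ValiantsHypothesis.Theorems.TwoProducts.DepthK
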